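import Summits.BirchSwinnertonDyer.BirchSwinnertonDyer.Theses.CountingDoorF2AtThree
import Summits.BirchSwinnertonDyer.Rank2.F2DensityAlgebra
import Literature.NumberTheory.EllipticCurves.BSDWave0Proofs
import HarnessLib

/-!
# BirchSwinnertonDyer / CountingDoorF2AtThree — support lemma for crux I1
# `SelmerThreeAverageLargeF2` (stmt-BirchSwinnertonDyer-19440): the EXPONENTIAL RANK MOMENT
# is the item's instrument (`avg 3^{rank E_a} ≤ avg #Sel₃(E_a)`), and its formal falsifier shape

Route `route-BirchSwinnertonDyer-CountingDoorF2AtThree` (cell bsd-rank2; TWIN leaf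
`PAdicBSDRankTwoPositiveProportion`). Crux I1 asks `Φ.AverageOnLE (fun a ↦ #Sel₃(E_a)) 36` for every
large subfamily `Φ` of Bhargava–Ho's `F₂`. No `3`-descent engine is available to the cell, so `#Sel₃`
itself is not computed on any member; what IS computed (bsd-rank2-eng GEN 3, exact `2`-descent law
`(r,R,s)` with `r = R` on every generic member of height `< 10⁹`, kit j250514/j251853, BALLS.md) is the
Mordell–Weil RANK. This file records, as tree theorems over the route's vocabulary, the elementary
fact that makes that rank law an instrument of I1 and states the falsifier in its correct (limsup)
shape:

* `averageOnLE_mono`: `AverageOnLE` is monotone in the integrand (member-wise `f ≤ g`).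
* `three_pow_mordellWeilRank_le_natCard_selmerGroup`: for every member `a` of `F₂`,
  `3^{rank E_a(ℚ)} ≤ 3^{rank E_a(ℚ)} · #E_a(ℚ)[3] ≤ #Sel₃(E_a)` (Kummer sequence, Silverman X.4.2, tree
  theorem `WeierstrassCurve.pow_mordellWeilRank_mul_card_torsionBy_le_card_selmerGroup`).
* `rankMomentThree_of_selmerThreeAverageLE`: on ANY subfamily `Φ` and for any constant `c`,
  `Φ.AverageOnLE #Sel₃ c → Φ.AverageOnLE (3^rank) c`; `rankMomentThree_of_selmerThreeAverageLargeF2`: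
  the route decl I1 (BY NAME) implies `limsup_X avg_{Φ(<X)} 3^{rank E_a} ≤ 36` on every large `Φ`.
* `not_selmerThreeAverageLargeF2_of_frequently_lt_rankMoment`: conversely, ONE large `Φ` and one
  `ε > 0` with `36 + ε < avg_{Φ(<X)} 3^{rank E_a}` for INFINITELY MANY `X` (`∃ᶠ X in atTop`) refute I1.
  A finite height ball never does: the numbers of record (eng g3 law, read by eng-2 GEN 2) are
  `avg 3^rank ∣ generic = 22.76 (X = 10⁷), 27.24 (10⁸), 31.39 (10⁹)`, rising ≈ 4 per decade with the
  rank-`≥ 4` share still growing (7.5 % → 11.8 % → 15.3 %); the Poonen–Rains limit of `avg #Sel₃` is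
  `36` while the minimalist limit of `avg 3^rank` is `(9 + 27)/2 = 18`, so the boxes are rank-inflated
  and the route text's «cheapest falsifier» must be read in this limsup form.

Nothing is asserted: no named fact is used (`finite_selmerGroup_holds`, `exists_kummerMap_holds`,
`module_finite_point_holds` behind the Literature lemma are tree theorems). PARTITION: none —
r_an ≥ 2, summit axis S0; TWIN (D-0056): n/a. B1 honesty: bookkeeping that types an instrument of an
OPEN crux; no analytic rank, no `L`-function; no S0 motion; I1 is neither proved nor refuted here.

References: J. Silverman, AEC X.4.2 (Kummer sequence `0 → E(K)/nE(K) → Sel^(n) → Ш[n] → 0`)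
[SilvermanAEC2009]; M. Bhargava, W. Ho, arXiv:2207.03309 (2022), Thm. 1.3 and §10 (ranks in `F₂`)
[BhargavaHo2022]; B. Poonen, E. Rains, J. AMS 25 (2012) (the model value `3²·(3+1) = 36`)
[PoonenRains2012].
-/

set_option linter.dupNamespace false

noncomputable section

open scoped Classical
open Filter Topology Finset
open WeierstrassCurve Literature.NumberTheory.EllipticCurves
  Literature.NumberTheory.EllipticCurves.BhargavaHo2022
  Summit.BirchSwinnertonDyer.Rank2
  Summit.BirchSwinnertonDyer.BirchSwinnertonDyer.Theses.CountingDoorF2AtThree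

namespace Summit.BirchSwinnertonDyer.BirchSwinnertonDyer.Theorems

variable (Φ : CongruenceFamily₂)

/-! ### §1 Monotonicity of `AverageOnLE` in the integrand -/

/-- `AverageOnLE` is monotone in the integrand: if `f ≤ g` member-wise on `Φ` and
`limsup avg g ≤ c` (ε-form), then `limsup avg f ≤ c`. [folklore] -/
theorem averageOnLE_mono {f g : Params → ℝ} {c : ℝ} (hg : Φ.AverageOnLE g c)
    (h : ∀ a, Φ.Mem a → f a ≤ g a) : Φ.AverageOnLE f c := fun ε hε ↦
  (hg ε hε).mono fun X hX ↦ (averageOn_mono Φ h X).trans hX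

/-! ### §2 `3^rank ≤ #Sel₃` member by member -/

/-- For every member `a` of `F₂` (so `E_a` is an elliptic curve over `ℚ`):
`3^{rank E_a(ℚ)} · #E_a(ℚ)[3] ≤ #Sel₃(E_a)` — the Kummer sequence `E(ℚ)/3E(ℚ) ↪ Sel₃(E)` with
`#(E(ℚ)/3E(ℚ)) = 3^rank · #E(ℚ)[3]` (Silverman X.4.2), as real numbers.
[cite: SilvermanAEC2009, Thm X.4.2] -/
theorem three_pow_mordellWeilRank_mul_natCard_torsionBy_le_natCard_selmerGroup (a : Params)
    (ha : a.IsMember) :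
    (3 : ℝ) ^ a.curve.mordellWeilRank *
        (Nat.card (AddSubgroup.torsionBy a.curve.toAffine.Point (3 : ℤ)) : ℝ) ≤
      (Nat.card (a.curve.selmerGroup 3) : ℝ) := by
  haveI := Params.isElliptic_curve ha
  -- the Literature lemma is stated with the classical `DecidableEq` instance behind the group law;
  -- `convert` identifies it with the instance found here (subsingleton)
  have h₀ := a.curve.pow_mordellWeilRank_mul_card_torsionBy_le_card_selmerGroup
    (n := 3) (by norm_num)
  simp only [Nat.cast_ofNat] at h₀
  have h : 3 ^ a.curve.mordellWeilRank *
      Nat.card (AddSubgroup.torsionBy a.curve.toAffine.Point (3 : ℤ)) ≤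
        Nat.card (a.curve.selmerGroup 3) := by
    convert h₀
  exact_mod_cast h

/-- For every member `a` of `F₂`: `3^{rank E_a(ℚ)} ≤ #Sel₃(E_a)` (`E(ℚ)/E(ℚ)_tors` is free of rank
`rank E(ℚ)` and maps onto `(ℤ/3)^rank`, which injects into `Sel₃` by the Kummer sequence; tree theorem
`WeierstrassCurve.pow_rank_le_card_selmerGroup`). [cite: SilvermanAEC2009, Thm X.4.2] -/
theorem three_pow_mordellWeilRank_le_natCard_selmerGroup (a : Params) (ha : a.IsMember) :
    (3 : ℝ) ^ a.curve.mordellWeilRank ≤ (Nat.card (a.curve.selmerGroup 3) : ℝ) := by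
  haveI := Params.isElliptic_curve ha
  have h := a.curve.pow_rank_le_card_selmerGroup (n := 3) (by norm_num)
  simp only [Nat.cast_ofNat] at h
  exact_mod_cast h

/-! ### §3 The exponential rank moment is bounded by the `3`-Selmer average -/

/-- **The rank law is an instrument of the `3`-Selmer average.** On any subfamily `Φ ⊆ F₂` and for
any constant `c`: `Φ.AverageOnLE (fun a ↦ #Sel₃(E_a)) c → Φ.AverageOnLE (fun a ↦ 3^{rank E_a}) c`.
[cite: SilvermanAEC2009, Thm X.4.2] -/
theorem rankMomentThree_of_selmerThreeAverageLE {c : ℝ}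
    (h : Φ.AverageOnLE (fun a ↦ (Nat.card (a.curve.selmerGroup 3) : ℝ)) c) :
    Φ.AverageOnLE (fun a ↦ (3 : ℝ) ^ a.curve.mordellWeilRank) c :=
  averageOnLE_mono Φ h fun a ha ↦ three_pow_mordellWeilRank_le_natCard_selmerGroup a ha.1

/-- The same with the torsion weight: `Φ.AverageOnLE #Sel₃ c → Φ.AverageOnLE (3^rank · #E(ℚ)[3]) c`
(the full size of `E(ℚ)/3E(ℚ)`). [cite: SilvermanAEC2009, Thm X.4.2] -/
theorem kummerQuotientMomentThree_of_selmerThreeAverageLE {c : ℝ}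
    (h : Φ.AverageOnLE (fun a ↦ (Nat.card (a.curve.selmerGroup 3) : ℝ)) c) :
    Φ.AverageOnLE (fun a ↦ (3 : ℝ) ^ a.curve.mordellWeilRank *
      (Nat.card (AddSubgroup.torsionBy a.curve.toAffine.Point (3 : ℤ)) : ℝ)) c :=
  averageOnLE_mono Φ h fun a ha ↦
    three_pow_mordellWeilRank_mul_natCard_torsionBy_le_natCard_selmerGroup a ha.1

/-- **I1 bounds the exponential rank moment on every large family**: the route decl
`SelmerThreeAverageLargeF2` (BY NAME) implies `limsup_X avg_{Φ(<X)} 3^{rank E_a(ℚ)} ≤ 36` (ε-form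
`AverageOnLE`) for every large `Φ ⊆ F₂`. The cell's exact rank law to height `10⁹` is thereby an
instrument of I1 (values of record: `22.76`, `27.24`, `31.39` at `10⁷`, `10⁸`, `10⁹`).
[cite: SilvermanAEC2009, Thm X.4.2; BhargavaHo2022, Thm. 1.3 (average rank of F₂)] -/
theorem rankMomentThree_of_selmerThreeAverageLargeF2 (h1 : SelmerThreeAverageLargeF2)
    (Φ : CongruenceFamily₂) (hΦ : Φ.IsLarge) :
    Φ.AverageOnLE (fun a ↦ (3 : ℝ) ^ a.curve.mordellWeilRank) 36 :=
  rankMomentThree_of_selmerThreeAverageLE Φ (h1 Φ hΦ)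

/-! ### §4 The falsifier in its correct (limsup) shape -/

/-- If on some subfamily `Φ` the finite averages of `f` exceed `c + ε` for INFINITELY MANY height
bounds `X` (`∃ᶠ X in atTop`), for one fixed `ε > 0`, then `Φ.AverageOnLE f c` fails. [folklore] -/
theorem not_averageOnLE_of_frequently_lt {f : Params → ℝ} {c ε : ℝ} (hε : 0 < ε)
    (hfreq : ∃ᶠ X : ℕ in atTop, c + ε < Φ.averageOn f X) : ¬ Φ.AverageOnLE f c := fun h ↦
  hfreq (by simpa only [not_lt] using h ε hε)

/-- **Formal falsifier of I1 through the rank law.** ONE large `Φ ⊆ F₂` and one `ε > 0` such that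
`36 + ε < avg_{a ∈ Φ(<X)} 3^{rank E_a(ℚ)}` for infinitely many `X` refute `SelmerThreeAverageLargeF2`.
(A single height ball, however large, does not: at `X = 10⁹` the value of record is `31.39` and the
boxes are still rank-inflated.) [cite: SilvermanAEC2009, Thm X.4.2] -/
theorem not_selmerThreeAverageLargeF2_of_frequently_lt_rankMoment (Φ : CongruenceFamily₂)
    (hΦ : Φ.IsLarge) {ε : ℝ} (hε : 0 < ε)
    (hfreq : ∃ᶠ X : ℕ in atTop,
      36 + ε < Φ.averageOn (fun a ↦ (3 : ℝ) ^ a.curve.mordellWeilRank) X) :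
    ¬ SelmerThreeAverageLargeF2 := fun h1 ↦
  not_averageOnLE_of_frequently_lt Φ hε hfreq (rankMomentThree_of_selmerThreeAverageLargeF2 h1 Φ hΦ)

/-- The same falsifier stated with the `3`-Selmer average itself (for a seat that one day computes
`#Sel₃` member-wise): one large `Φ`, one `ε > 0`, and `36 + ε < avg_{Φ(<X)} #Sel₃` for infinitely many
`X` refute I1. [folklore] -/
theorem not_selmerThreeAverageLargeF2_of_frequently_lt (Φ : CongruenceFamily₂) (hΦ : Φ.IsLarge)
    {ε : ℝ} (hε : 0 < ε)
    (hfreq : ∃ᶠ X : ℕ in atTop,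
      36 + ε < Φ.averageOn (fun a ↦ (Nat.card (a.curve.selmerGroup 3) : ℝ)) X) :
    ¬ SelmerThreeAverageLargeF2 := fun h1 ↦
  not_averageOnLE_of_frequently_lt Φ hε hfreq (h1 Φ hΦ)

end Summit.BirchSwinnertonDyer.BirchSwinnertonDyer.Theorems

end
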